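import Summits.ResolutionOfSingularities.ResolutionOfSingularities.Theorems.HilbertSamuelEliminationCampaignW42TertiaryCompactnessGeneral
import Summits.ResolutionOfSingularities.ResolutionOfSingularities.Theorems.HilbertSamuelEliminationSigmaMaxModificationsCorridor3MovingCompactnessRunLabelling
import Mathlib.Topology.NoetherianSpace
import Mathlib.Topology.Separation.Basic
import HarnessLib

/-!
# Route `HilbertSamuelElimination`, crux `SigmaMaxModificationsCorridor3` (stmt-ResolutionOfSingularities-19249; child of
# `SigmaMaxModifications` stmt-…-18506), registered skeleton `w_ladder` v5/v5b MOVING (e55bf4f23146f08b / 15b216069fa8234a), stub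
# `stub_movingCompactness` (L∞) — second layer, HELPER STUB 3 of idea-2's line `moving-compactness`, part 2/3:
# NOETHERIAN PERSISTENCE OF THE LABEL-`j` PARTS `Y_m^{(j)}` ALONG THE CANONICAL RUNS

[OURS · L1 W4.2] (cell res-hironaka, LADDER-RESOLUTION rung L, D-0089; reserve prover seat res-type-064 gen 10, holder of helper
stub 3 `stub_movingChain_of_leastLabel_eventuallyConst` of `L/res-L1-w42-idea-2/Line-moving-compactness.lean` 89d540dcceefd65f on
res-L1-w42-plan-1's word 04:28:23Z / 04:59:04Z). NOT statements of H. Hironaka's manuscript [Hironaka2017]; nothing of the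
manuscript is used or asserted. AI review is weaker than expert review. Pure PROOF file; no definition (the persistence
predicates are spelled inline, as in the tree's T∞ file `…CampaignW42TertiaryCompactnessGeneral`).

THE METHOD. Helper stub 3 says: along a chain of closed near points of `S(X, ν)` on which the LEAST LABEL PRESENT is eventually
constant `= j`, SOME closed point of `X(ν)` starts a chain of closed near points which is BLOWN UP INFINITELY OFTEN. Instead of
idea-2's Kőnig argument on the domination forest of label-`j` components, this file runs the tree's NOETHERIAN PERSISTENCE
argument (res-L1-s42-pv-2's `exists_persistent_closedPt` / `exists_canonicalNearStep_of_persistent`: closed decreasing images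
of the strata along THE canonical runs stabilise; a closed point of the intersection threads the chain) INSIDE THE LABEL-`j`
PARTS `Y_m^{(j)}` of the strata, read at the top of a run by `runLabelling` (part 1/3, p498069):

* `base_mem_part_of_mem_next_part` — label descent along ONE blow-up: a label `j ≠ year + 1` upstairs is INHERITED (tree
  `Labelling.next_label_of_mem` / `_of_not_mem`), so the label-`j` part upstairs maps into the label-`j` part downstairs.
* `exists_run_pred_part` — LAST-STEP BOOKKEEPING for the parts: along canonical runs of length `m + 1` from a state with
  `j ≤ year + m`, a point of `Y_{m+1}^{(j)}` lies over a point of `Y_m^{(j)}` (peeling the first centre, as the tree's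
  `exists_run_pred_of_run_succ` does for the strata).
* `exists_run_eq_of_chain` — the chain ↔ run dictionary: the `n`-th marked stage of a chain of canonical near steps from `s₀` IS
  `⟨t.top, _, runLabelling N ν s₀.L t, _, _⟩` for a canonical run `t` of length `n` from the state of `s₀` (so «least label
  `= j` at the `n`-th stage» becomes «`Y_n^{(j)} ≠ ∅` at the top of THE canonical run», functional oracle).
* `exists_next_pt_of_partPersistent` — THE SUCCESSOR STEP: a closed marked point in a good state which is `j`-persistent from the
  year `n₁ > j` on (every canonical run from the state carries a stratum point over it, inside `Y^{(j)}` once the year at the top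
  is `≥ n₁`) has, along the canonical step, a closed stratum point over it of the same kind.
* `exists_partPersistent_closedPt` — THE INITIAL POINT: if `S(X, ν)` is infinite from a good initial state and `Y_m^{(j)} ≠ ∅` at
  the top of every canonical run of length `m ≥ n₁`, some closed point of `X(ν)` is `j`-persistent from the year `n₁` on.

Part 3/3 (`…MovingCompactnessEventuallyConst`) threads the points and reads off «blown up infinitely often» from res-type-005's
cycle-end lemma `exists_cycleEnd_of_leastLabel_eventuallyConst` (p498054: at every later END of a resolution cycle for the label
`j` the canonical centre is the whole part `Y_m^{(j)}`).

## References

* V. Cossart, U. Jannsen, S. Saito, *Desingularization: Invariants and Strategy*, LNM 2270 (2020), Rem. 6.29 (1) pp. 91–92, (6.5),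
  proof of Thm. 6.28 Step 7 p. 95, p. 105, p. 107. [CossartJannsenSaito2020]
* tree: `…Theorems.HilbertSamuelEliminationCampaignW42TertiaryCompactnessGeneral` (T∞), `…TertiaryStates` (`StateGood`,
  `exists_run_pred_of_run_succ`, `exists_stateGood_top_of_run`, `hsStratum_top_nonempty_of_runs`),
  `Literature.AlgebraicGeometry.Resolution.CanonicalEliminationSequence` (`Labelling.next/part`, `IsCanonicalRunFrom.eq_of_length_eq`).
* cell files: `L/w42/CHAIN.md` §0f (S2); `L/res-L1-w42-idea-2/Line-moving-compactness.lean` (sha16 89d540dcceefd65f).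
-/

noncomputable section

set_option linter.dupNamespace false -- mandated namespace of this single-conjunct summit

open CategoryTheory AlgebraicGeometry TopologicalSpace Topology
open Summit.ResolutionOfSingularities.ResolutionOfSingularities.Theorems.CampaignW42
open Literature.AlgebraicGeometry.Resolution Literature.RingTheory.HilbertSamuel

namespace Summit.ResolutionOfSingularities.ResolutionOfSingularities.Cruxes.SigmaMaxModifications.MovingCompactnessLine

universe u

variable {R : ∀ S : Scheme.{u}, CentreSeq S → Prop} {N : ℕ} {ν : ℕ → ℕ}
variable {k : Type u} [Field k]

/-! ## Label descent along one blow-up: a label that is not the new year is inherited -/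

/-- **An old label is inherited.** If `j` is not the new year `year + 1`, a point of the label-`j` part upstairs of a
blow-up (for the updated labelling `L.next Y C` and any set `Y'` upstairs) maps to the label-`j` part `Y^{(j)}` downstairs:
its component upstairs has label `j ≠ year + 1`, so by the tree's `Labelling.next` it dominates a component of `Y` of label
`j`, which contains the image. [cite: CossartJannsenSaito2020, Rem. 6.29 (1)] -/
theorem base_mem_part_of_mem_next_part {W : Scheme.{u}} (L : Labelling W) (Y : Set W) (C : W.IdealSheafData) {j : ℕ}
    (hj : j ≠ L.year + 1) {Y' : Set ↥(blowup C)} {z' : ↥(blowup C)} (hz' : z' ∈ (L.next Y C).part Y' j) :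
    (blowup.π C).base z' ∈ L.part Y j := by
  obtain ⟨Z, hZ, hl, hzZ⟩ := ((L.next Y C).mem_part_iff Y' j z').mp hz'
  by_cases hdom : closure (blowup.π C '' Z) ∈ componentsIn Y
  · rw [Labelling.next_label_of_mem _ _ hdom] at hl
    exact (L.mem_part_iff Y j _).mpr ⟨_, hdom, hl, subset_closure ⟨z', hzZ, rfl⟩⟩
  · rw [Labelling.next_label_of_not_mem _ _ hdom] at hl
    exact absurd hl.symm hj

/-! ## Descent of the label-`j` part along a canonical run (peeling the first centre) -/

/-- **LAST-STEP BOOKKEEPING FOR THE LABEL-`j` PART.** Along canonical runs of length `m + 1` from a state whose year satisfies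
`j ≤ year + m` (so that `j` is an OLD label at the last blow-up), every point of the label-`j` part at depth `m + 1` lies
over a point of the label-`j` part at depth `m` (with the same image at depth `0`). [cite: CossartJannsenSaito2020, Rem. 6.29 (1)] -/
theorem exists_run_pred_part (j m : ℕ) :
    ∀ {W : Scheme.{u}} {L : Labelling W} {P : Option (Pending W)} (t' : CentreSeq W),
      IsCanonicalRunFrom R N ν L P t' → t'.length = m + 1 → j ≤ L.year + m →
      ∀ z' : t'.top, z' ∈ (runLabelling N ν L t').part (Scheme.hsStratum t'.top N ν) j →
        ∃ t : CentreSeq W, IsCanonicalRunFrom R N ν L P t ∧ t.length = m ∧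
          ∃ z : t.top, z ∈ (runLabelling N ν L t).part (Scheme.hsStratum t.top N ν) j ∧
            t.comp.base z = t'.comp.base z' := by
  induction m with
  | zero =>
    intro W L P t' ht' hlen hj z' hz'
    cases t' with
    | nil _ => simp at hlen
    | cons C rest =>
      obtain ⟨P', hst, hrest⟩ := ht'
      cases rest with
      | cons _ _ => simp at hlen
      | nil _ =>
        exact ⟨CentreSeq.nil W, trivial, rfl, (blowup.π C).base z',
          base_mem_part_of_mem_next_part L _ C (by omega) hz', rfl⟩
  | succ m ih =>
    intro W L P t' ht' hlen hj z' hz'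
    cases t' with
    | nil _ => simp at hlen
    | cons C r' =>
      obtain ⟨P', hst, hr'⟩ := ht'
      have hlen' : r'.length = m + 1 := by simpa using hlen
      have hj' : j ≤ (L.next (Scheme.hsStratum W N ν) C).year + m := by rw [Labelling.next_year]; omega
      obtain ⟨r, hr, hrlen, z, hz, hzeq⟩ := ih r' hr' hlen' hj' z' hz'
      refine ⟨CentreSeq.cons C r, ⟨P', hst, hr⟩, by simp [hrlen], z, hz, ?_⟩
      show (blowup.π C).base (r.comp.base z) = (blowup.π C).base (r'.comp.base z')
      rw [hzeq]

/-! ## The chain ↔ run dictionary -/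

/-- **A chain of canonical near steps runs along THE canonical run**: the `n`-th marked stage of a chain from `s₀` is the top
of a canonical run of length `n` from the state of `s₀`, carrying the run's labelling `runLabelling` (its cycle state and
marked point being whatever they are). [folklore] -/
theorem exists_run_eq_of_chain (n : ℕ) :
    ∀ (s₀ : MarkedStage.{u}) (c : ℕ → MarkedStage.{u}), c 0 = s₀ →
      (∀ i, CanonicalNearStep R N ν (c i) (c (i + 1))) →
      ∃ t : CentreSeq s₀.W, IsCanonicalRunFrom R N ν s₀.L s₀.P t ∧ t.length = n ∧
        ∃ (h : IsLocallyNoetherian t.top) (P : Option (Pending t.top)) (y : t.top),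
          c n = ⟨t.top, h, runLabelling N ν s₀.L t, P, y⟩ := by
  induction n with
  | zero =>
    intro s₀ c hc0 _
    exact ⟨CentreSeq.nil _, trivial, rfl, s₀.ln, s₀.P, s₀.pt, hc0⟩
  | succ n ih =>
    intro s₀ c hc0 hstep
    subst hc0
    obtain ⟨C, P', hln, x', hst, -, -, -, h1⟩ := hstep 0
    obtain ⟨t, ht, hlen, h, P, y, hcn⟩ :=
      ih ⟨blowup C, hln, (c 0).L.next (Scheme.hsStratum (c 0).W N ν) C, P', x'⟩ (fun i => c (i + 1)) h1
        fun i => hstep (i + 1)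
    exact ⟨CentreSeq.cons C t, ⟨P', hst, ht⟩, by simp [hlen], h, P, y, hcn⟩

/-! ## Persistence of the label-`j` part: the successor step -/

/-- **THE SUCCESSOR STEP for the label-`j` part (functional oracle).** From a marked stage in a good state with runs of every
length, whose marked point is CLOSED and `j`-PERSISTENT from the year `n₁ > j` on — every canonical run `t` from the state
has a stratum point over the marked point which lies in the label-`j` part `Y^{(j)}` at the top as soon as the year there,
`year + t.length`, is at least `n₁` — the canonical step leads to a marked point of the same kind over it. The sets `A_m` of
points of the blow-up over the marked point carrying such a depth-`m` point are closed (proper images of closed parts,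
`Labelling.isClosed_part`), non-empty, and decreasing by the label descent `exists_run_pred_part`; they stabilise (Noetherian
induction) and a closed point of their intersection is the next marked point — the T∞ argument of
`exists_canonicalNearStep_of_persistent` run inside the label-`j` parts. [cite: CossartJannsenSaito2020, Rem. 6.29 (1), p. 105] -/
theorem exists_next_pt_of_partPersistent (hRf : OracleFunctional R) {j n₁ : ℕ} (hjn : j < n₁) {s : MarkedStage.{u}}
    (hcl : IsClosed ({s.pt} : Set s.W)) (hgood : StateGood k R N ν s.W s.L s.P)
    (hinf : ∀ m, ∃ t : CentreSeq s.W, IsCanonicalRunFrom R N ν s.L s.P t ∧ t.length = m)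
    (hpers : ∀ t : CentreSeq s.W, IsCanonicalRunFrom R N ν s.L s.P t →
      ∃ z : t.top, (n₁ ≤ s.L.year + t.length →
          z ∈ (runLabelling N ν s.L t).part (Scheme.hsStratum t.top N ν) j) ∧
        z ∈ Scheme.hsStratum t.top N ν ∧ t.comp.base z = s.pt)
    {C : s.W.IdealSheafData} {P' : Option (Pending (blowup C))} (hst : IsCanonicalStep R N ν s.L s.P C P') :
    ∃ y' : ↥(blowup C), (blowup.π C).base y' = s.pt ∧ IsClosed ({y'} : Set ↥(blowup C)) ∧
      y' ∈ Scheme.hsStratum (blowup C) N ν ∧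
      (∀ m, ∃ t : CentreSeq (blowup C),
        IsCanonicalRunFrom R N ν (s.L.next (Scheme.hsStratum s.W N ν) C) P' t ∧ t.length = m) ∧
      ∀ t : CentreSeq (blowup C), IsCanonicalRunFrom R N ν (s.L.next (Scheme.hsStratum s.W N ν) C) P' t →
        ∃ z : t.top, (n₁ ≤ (s.L.next (Scheme.hsStratum s.W N ν) C).year + t.length →
            z ∈ (runLabelling N ν (s.L.next (Scheme.hsStratum s.W N ν) C) t).part (Scheme.hsStratum t.top N ν) j) ∧
          z ∈ Scheme.hsStratum t.top N ν ∧ t.comp.base z = y' := by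
  haveI : IsLocallyNoetherian s.W := s.ln
  set L' : Labelling (blowup C) := s.L.next (Scheme.hsStratum s.W N ν) C with hL'
  have hL'y : L'.year = s.L.year + 1 := rfl
  have hgood' : StateGood k R N ν (blowup C) L' P' := hgood.next hst
  haveI : IsLocallyNoetherian (blowup C) := hgood'.isLocallyNoetherian
  haveI : IsNoetherian (blowup C) := hgood'.isNoetherian
  -- runs from the next state
  have hinf' : ∀ m, ∃ r : CentreSeq (blowup C), IsCanonicalRunFrom R N ν L' P' r ∧ r.length = m := by
    intro m
    obtain ⟨t, ht, hlen⟩ := hinf (m + 1)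
    obtain ⟨rest, rfl, hrest, hrlen⟩ := exists_eq_cons_of_run hRf hst ht hlen
    exact ⟨rest, hrest, hrlen⟩
  choose r hr hrlen using hinf'
  have hruniq : ∀ {m} (t : CentreSeq (blowup C)), IsCanonicalRunFrom R N ν L' P' t → t.length = m → t = r m :=
    fun t ht hlen => IsCanonicalRunFrom.eq_of_length_eq hRf ht (hr _) (hlen.trans (hrlen _).symm)
  -- the good set at depth `m`: stratum points, in the label-`j` part once the year there is at least `n₁`
  let Q : ∀ m, Set ↥((r m).top) := fun m =>
    {z | (n₁ ≤ L'.year + m → z ∈ (runLabelling N ν L' (r m)).part (Scheme.hsStratum (r m).top N ν) j) ∧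
      z ∈ Scheme.hsStratum (r m).top N ν}
  have hQclosed : ∀ m, IsClosed (Q m) := by
    intro m
    obtain ⟨L₂, P₂, hgtop⟩ := exists_stateGood_top_of_run m hgood' (r m) (hr m) (hrlen m)
    haveI : IsNoetherian (r m).top := hgtop.isNoetherian
    have hstr : IsClosed (Scheme.hsStratum (r m).top N ν) := hgtop.isClosed_hsStratum
    by_cases hc : n₁ ≤ L'.year + m
    · have hpart : IsClosed ((runLabelling N ν L' (r m)).part (Scheme.hsStratum (r m).top N ν) j) :=
        Labelling.isClosed_part _ hstr (componentsIn.finite _) j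
      have hQ : Q m = (runLabelling N ν L' (r m)).part (Scheme.hsStratum (r m).top N ν) j ∩
          Scheme.hsStratum (r m).top N ν := by
        ext z
        simp only [Q, Set.mem_setOf_eq, Set.mem_inter_iff]
        exact ⟨fun h => ⟨h.1 hc, h.2⟩, fun h => ⟨fun _ => h.1, h.2⟩⟩
      rw [hQ]
      exact hpart.inter hstr
    · have hQ : Q m = Scheme.hsStratum (r m).top N ν := by
        ext z
        simp only [Q, Set.mem_setOf_eq]
        exact ⟨fun h => h.2, fun h => ⟨fun h' => absurd h' hc, h⟩⟩
      rw [hQ]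
      exact hstr
  -- the sets `A m`
  let A : ℕ → Set ↥(blowup C) := fun m =>
    {y' | (blowup.π C).base y' = s.pt ∧ ∃ z : (r m).top, z ∈ Q m ∧ (r m).comp.base z = y'}
  have hAclosed : ∀ m, IsClosed (A m) := by
    intro m
    have h1 : IsClosed ((fun y' : ↥(blowup C) => (blowup.π C).base y') ⁻¹' {s.pt}) :=
      hcl.preimage (blowup.π C).continuous
    haveI : IsProper (r m).comp := CentreSeq.isProper_comp (r m)
    have h2 : IsClosed ((fun z : ↥((r m).top) => (r m).comp.base z) '' Q m) :=
      (r m).comp.isClosedMap _ (hQclosed m)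
    have hA : A m = ((fun y' : ↥(blowup C) => (blowup.π C).base y') ⁻¹' {s.pt}) ∩
        ((fun z : ↥((r m).top) => (r m).comp.base z) '' Q m) := by
      ext y'
      simp only [A, Set.mem_setOf_eq, Set.mem_inter_iff, Set.mem_preimage, Set.mem_singleton_iff, Set.mem_image]
    rw [hA]
    exact h1.inter h2
  have hAne : ∀ m, (A m).Nonempty := by
    intro m
    obtain ⟨z, hzc, hzs, hzeq⟩ := hpers (CentreSeq.cons C (r m)) ⟨P', hst, hr m⟩
    refine ⟨(r m).comp.base z, hzeq, z, ⟨fun hc => hzc ?_, hzs⟩, rfl⟩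
    rw [CentreSeq.length_cons, hrlen]
    omega
  have hAanti : ∀ m, A (m + 1) ⊆ A m := by
    intro m y' hy'
    obtain ⟨hπ, z', ⟨hz'c, hz's⟩, hzeq'⟩ := hy'
    by_cases hc : n₁ ≤ L'.year + m
    · have hz'p := hz'c (by omega)
      obtain ⟨t, ht, htlen, z, hz, hzeq⟩ :=
        exists_run_pred_part j m (r (m + 1)) (hr _) (hrlen _) (by omega) z' hz'p
      obtain rfl : t = r m := hruniq t ht htlen
      exact ⟨hπ, z, ⟨fun _ => hz, runLabelling_part_subset _ _ _ hz⟩, hzeq.trans hzeq'⟩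
    · obtain ⟨t, ht, htlen, z, hz, hzeq⟩ :=
        exists_run_pred_of_run_succ m hgood' (r (m + 1)) (hr _) (hrlen _) z' hz's
      obtain rfl : t = r m := hruniq t ht htlen
      exact ⟨hπ, z, ⟨fun h => absurd h hc, hz⟩, hzeq.trans hzeq'⟩
  have hAanti' : Antitone A := antitone_nat_of_succ_le hAanti
  obtain ⟨M, hM⟩ : ∃ M, ∀ m, M ≤ m → A m = A M := by
    let F : ℕ → Closeds ↥(blowup C) := fun m => ⟨A m, hAclosed m⟩
    obtain ⟨B, ⟨M, rfl⟩, hmin⟩ :=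
      (wellFounded_lt (α := Closeds ↥(blowup C))).has_min (Set.range F) ⟨F 0, 0, rfl⟩
    refine ⟨M, fun m hm => ?_⟩
    have hle : F m ≤ F M := hAanti' hm
    have hnlt : ¬ F m < F M := hmin (F m) ⟨m, rfl⟩
    have heq : F m = F M := hle.eq_or_lt.resolve_right hnlt
    exact congrArg (fun B : Closeds ↥(blowup C) => (B : Set ↥(blowup C))) heq
  haveI : CompactSpace ↥(blowup C) := inferInstance
  obtain ⟨y', hy'M, hy'cl⟩ := (hAclosed M).exists_closed_singleton (hAne M)
  have hy' : ∀ m, y' ∈ A m := by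
    intro m
    rcases le_total M m with hm | hm
    · rw [hM m hm]; exact hy'M
    · exact hAanti' hm hy'M
  obtain ⟨hπy', z₀, ⟨-, hz₀⟩, hz₀eq⟩ := hy' 0
  have hr0 : r 0 = CentreSeq.nil _ := by
    have := hrlen 0
    cases h : r 0 with
    | nil _ => rfl
    | cons _ _ => rw [h] at this; simp at this
  have hy'str : y' ∈ Scheme.hsStratum (blowup C) N ν := by
    have key : ∀ (t : CentreSeq (blowup C)) (ht : t = CentreSeq.nil _) (z : t.top),
        z ∈ Scheme.hsStratum t.top N ν → t.comp.base z = y' → y' ∈ Scheme.hsStratum (blowup C) N ν := by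
      intro t ht z hz hzeq
      subst ht
      simpa using (show (CentreSeq.nil (blowup C)).comp.base z = y' from hzeq) ▸ hz
    exact key (r 0) hr0 z₀ hz₀ hz₀eq
  refine ⟨y', hπy', hy'cl, hy'str, fun m => ⟨r m, hr m, hrlen m⟩, fun t ht => ?_⟩
  obtain ⟨m, hm⟩ : ∃ m, t.length = m := ⟨_, rfl⟩
  obtain rfl : t = r m := hruniq t ht hm
  obtain ⟨-, z, ⟨hzc, hzs⟩, hzeq⟩ := hy' m
  exact ⟨z, fun hc => hzc (by rw [hrlen] at hc; exact hc), hzs, hzeq⟩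

/-! ## Persistence of the label-`j` part: the initial point -/

/-- **THE INITIAL POINT for the label-`j` part (functional oracle).** If `S(X, ν)` is infinite from a good initial state and
the label-`j` part `Y_m^{(j)}` at the top of the canonical run of every length `m ≥ n₁` (`n₁ > j`) is non-empty, SOME CLOSED
POINT `x₀ ∈ X(ν)` is `j`-persistent from the year `n₁` on: every canonical run `t` has a stratum point over `x₀`, lying in
`Y^{(j)}` at the top as soon as `t.length ≥ n₁`. The images `B_m ⊆ X` of the depth-`m` good sets are closed (proper), non-empty,
decreasing (label descent); they stabilise (Noetherian `X`); a closed point of their intersection will do (`B_0 ⊆ X(ν)`).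
[cite: CossartJannsenSaito2020, Rem. 6.29 (1), p. 105, p. 107] -/
theorem exists_partPersistent_closedPt (hRf : OracleFunctional R) {j n₁ : ℕ} (hjn : j < n₁) {X : Scheme.{u}}
    (hgood : StateGood k R N ν X (Labelling.init X) none) (hinf : CanonicalSequenceInfinite R N ν X)
    (hpart : ∀ t : CentreSeq X, t.IsCanonicalRun R N ν → n₁ ≤ (Labelling.init X).year + t.length →
      ((runLabelling N ν (Labelling.init X) t).part (Scheme.hsStratum t.top N ν) j).Nonempty) :
    ∃ x : X, x ∈ Scheme.hsStratum X N ν ∧ IsClosed ({x} : Set X) ∧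
      ∀ t : CentreSeq X, t.IsCanonicalRun R N ν →
        ∃ z : t.top, (n₁ ≤ (Labelling.init X).year + t.length →
            z ∈ (runLabelling N ν (Labelling.init X) t).part (Scheme.hsStratum t.top N ν) j) ∧
          z ∈ Scheme.hsStratum t.top N ν ∧ t.comp.base z = x := by
  haveI : IsLocallyNoetherian X := hgood.isLocallyNoetherian
  haveI : IsNoetherian X := hgood.isNoetherian
  choose r hr hrlen using hinf
  have hruniq : ∀ {m} (t : CentreSeq X), t.IsCanonicalRun R N ν → t.length = m → t = r m :=
    fun t ht hlen => CentreSeq.IsCanonicalRun.eq_of_length_eq hRf ht (hr _) (hlen.trans (hrlen _).symm)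
  let Q : ∀ m, Set ↥((r m).top) := fun m =>
    {z | (n₁ ≤ (Labelling.init X).year + m →
        z ∈ (runLabelling N ν (Labelling.init X) (r m)).part (Scheme.hsStratum (r m).top N ν) j) ∧
      z ∈ Scheme.hsStratum (r m).top N ν}
  have hQclosed : ∀ m, IsClosed (Q m) := by
    intro m
    obtain ⟨L₂, P₂, hgtop⟩ := exists_stateGood_top_of_run m hgood (r m) (hr m) (hrlen m)
    haveI : IsNoetherian (r m).top := hgtop.isNoetherian
    have hstr : IsClosed (Scheme.hsStratum (r m).top N ν) := hgtop.isClosed_hsStratum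
    by_cases hc : n₁ ≤ (Labelling.init X).year + m
    · have hp : IsClosed ((runLabelling N ν (Labelling.init X) (r m)).part (Scheme.hsStratum (r m).top N ν) j) :=
        Labelling.isClosed_part _ hstr (componentsIn.finite _) j
      have hQ : Q m = (runLabelling N ν (Labelling.init X) (r m)).part (Scheme.hsStratum (r m).top N ν) j ∩
          Scheme.hsStratum (r m).top N ν := by
        ext z
        simp only [Q, Set.mem_setOf_eq, Set.mem_inter_iff]
        exact ⟨fun h => ⟨h.1 hc, h.2⟩, fun h => ⟨fun _ => h.1, h.2⟩⟩
      rw [hQ]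
      exact hp.inter hstr
    · have hQ : Q m = Scheme.hsStratum (r m).top N ν := by
        ext z
        simp only [Q, Set.mem_setOf_eq]
        exact ⟨fun h => h.2, fun h => ⟨fun h' => absurd h' hc, h⟩⟩
      rw [hQ]
      exact hstr
  let B : ℕ → Set X := fun m => {y | ∃ z : (r m).top, z ∈ Q m ∧ (r m).comp.base z = y}
  have hBclosed : ∀ m, IsClosed (B m) := by
    intro m
    haveI : IsProper (r m).comp := CentreSeq.isProper_comp (r m)
    have h2 : IsClosed ((fun z : ↥((r m).top) => (r m).comp.base z) '' Q m) :=
      (r m).comp.isClosedMap _ (hQclosed m)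
    have hB : B m = (fun z : ↥((r m).top) => (r m).comp.base z) '' Q m := by
      ext y
      simp only [B, Set.mem_setOf_eq, Set.mem_image]
    rw [hB]
    exact h2
  have hBne : ∀ m, (B m).Nonempty := by
    intro m
    by_cases hc : n₁ ≤ (Labelling.init X).year + m
    · obtain ⟨z, hz⟩ := hpart (r m) (hr m) (by rw [hrlen]; exact hc)
      exact ⟨(r m).comp.base z, z, ⟨fun _ => hz, runLabelling_part_subset _ _ _ hz⟩, rfl⟩
    · obtain ⟨z, hz⟩ := hsStratum_top_nonempty_of_runs hRf m (r m) (hr m) (hrlen m) ⟨r (m + 1), hr _, hrlen _⟩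
      exact ⟨(r m).comp.base z, z, ⟨fun h => absurd h hc, hz⟩, rfl⟩
  have hBanti : ∀ m, B (m + 1) ⊆ B m := by
    intro m y hy
    obtain ⟨z', ⟨hz'c, hz's⟩, hzeq'⟩ := hy
    by_cases hc : n₁ ≤ (Labelling.init X).year + m
    · have hz'p := hz'c (by omega)
      obtain ⟨t, ht, htlen, z, hz, hzeq⟩ :=
        exists_run_pred_part j m (r (m + 1)) (hr _) (hrlen _) (by omega) z' hz'p
      obtain rfl : t = r m := hruniq t ht htlen
      exact ⟨z, ⟨fun _ => hz, runLabelling_part_subset _ _ _ hz⟩, hzeq.trans hzeq'⟩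
    · obtain ⟨t, ht, htlen, z, hz, hzeq⟩ := exists_run_pred_of_run_succ m hgood (r (m + 1)) (hr _) (hrlen _) z' hz's
      obtain rfl : t = r m := hruniq t ht htlen
      exact ⟨z, ⟨fun h => absurd h hc, hz⟩, hzeq.trans hzeq'⟩
  have hBanti' : Antitone B := antitone_nat_of_succ_le hBanti
  obtain ⟨M, hM⟩ : ∃ M, ∀ m, M ≤ m → B m = B M := by
    let F : ℕ → Closeds X := fun m => ⟨B m, hBclosed m⟩
    obtain ⟨B', ⟨M, rfl⟩, hmin⟩ := (wellFounded_lt (α := Closeds X)).has_min (Set.range F) ⟨F 0, 0, rfl⟩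
    refine ⟨M, fun m hm => ?_⟩
    have hle : F m ≤ F M := hBanti' hm
    have hnlt : ¬ F m < F M := hmin (F m) ⟨m, rfl⟩
    have heq : F m = F M := hle.eq_or_lt.resolve_right hnlt
    exact congrArg (fun B : Closeds X => (B : Set X)) heq
  haveI : CompactSpace X := inferInstance
  obtain ⟨x, hxM, hxcl⟩ := (hBclosed M).exists_closed_singleton (hBne M)
  have hx : ∀ m, x ∈ B m := by
    intro m
    rcases le_total M m with hm | hm
    · rw [hM m hm]; exact hxM
    · exact hBanti' hm hxM
  have hr0 : r 0 = CentreSeq.nil _ := by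
    have := hrlen 0
    cases h : r 0 with
    | nil _ => rfl
    | cons _ _ => rw [h] at this; simp at this
  have hxstr : x ∈ Scheme.hsStratum X N ν := by
    obtain ⟨z₀, ⟨-, hz₀⟩, hz₀eq⟩ := hx 0
    have key : ∀ (t : CentreSeq X) (ht : t = CentreSeq.nil _) (z : t.top),
        z ∈ Scheme.hsStratum t.top N ν → t.comp.base z = x → x ∈ Scheme.hsStratum X N ν := by
      intro t ht z hz hzeq
      subst ht
      simpa using (show (CentreSeq.nil X).comp.base z = x from hzeq) ▸ hz
    exact key (r 0) hr0 z₀ hz₀ hz₀eq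
  refine ⟨x, hxstr, hxcl, fun t ht => ?_⟩
  obtain ⟨m, hm⟩ : ∃ m, t.length = m := ⟨_, rfl⟩
  obtain rfl : t = r m := hruniq t ht hm
  obtain ⟨z, ⟨hzc, hzs⟩, hzeq⟩ := hx m
  exact ⟨z, fun hc => hzc (by rw [hrlen] at hc; exact hc), hzs, hzeq⟩


end Summit.ResolutionOfSingularities.ResolutionOfSingularities.Cruxes.SigmaMaxModifications.MovingCompactnessLine

end
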